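import Summits.QuantumFields.YangMills.Theorems.FradkinShenkerFlowSusceptibilityToPoincareLinkSetPoincare
import Summits.QuantumFields.YangMills.Theorems.FradkinShenkerFlowSusceptibilityToPoincarePinnedClusterBound
import Summits.QuantumFields.YangMills.Theorems.FradkinShenkerFlowSusceptibilityToPoincareFreeClusterTail
import Summits.QuantumFields.YangMills.Theorems.FradkinShenkerFlowSusceptibilityToPoincarePlantedTerminal
import Literature.MathematicalPhysics.QuantumFieldTheory.LatticeGaugeProofs

/-!
# The planted terminal Poincaré inequality HOLDS (line `planted-link-pinning`, crux `SusceptibilityToPoincare`)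

Route `FradkinShenkerFlow` of `YangMills`, crux item `stmt-QuantumFields-9441`
(`Summit.QuantumFields.YangMills.Theses.FradkinShenkerFlow.SusceptibilityToPoincare`, FS ⇒ UP).

The planner's stub S3 `stub_plantedTerminal` of `Cruxes/SusceptibilityToPoincare/Lines/planted-link-pinning.lean`
(terminal stage of the planted link-pinning localisation) is now an UNCONDITIONAL THEOREM for every compact group `G`
with a lattice representation `r` and every real `β`: composing the four landed registered stubs of the lead's reshape
(skeleton sha 321c414b) —
`stub_linkSetPoincare` (S3c, p97050: residual variance off a finite link set `≤ A·B^{#D}·Σ_{ℓ∈D} hb_ℓ`),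
`stub_pinnedClusterBound` (S3d, p100089: fixed pins, plaquette-closed blocks, block Efron–Stein + Markov property),
`stub_freeClusterTail` (S3e: planted free clusters have an exponential moment uniformly in the volume),
`stub_plantedTerminal` (S3f: the assembly) — gives

  `∃ ε₀ ∈ (0,1) ∀ ε ∈ (0,ε₀] ∃ C ≥ 0 ∀ S ∀ F bounded measurable:
     PCV_ε(F) := Σ_Λ ε^{#Λᶜ}(1−ε)^{#Λ} ∫ Var_μ[F | σ(U_Λ)] dμ ≤ C · Σ_ℓ ∫∫ (F U − F(U[ℓ↦g]))² dν_ℓ^U dμ`,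

`μ = wilsonMeasure r.ρ β` on the torus `(ℤ/(2S+1))⁴`, `ν_ℓ^U` the one-link heat-bath law: pinning every link
independently with probability `1 − ε` at its PLANTED value leaves, on average, at most `C` heat-bath Dirichlet units
of conditional variance, uniformly in the volume, once the free density is below `ε₀(G, r, β)` (subcritical free
clusters).  Recorded in both currencies (`μW`-binder form = the registered signature's conclusion, and the direct form).
-/

noncomputable section

open MeasureTheory ProbabilityTheory
open Literature.MathematicalPhysics.QuantumFieldTheory

namespace Summit.QuantumFields.YangMills.Theorems.SusceptibilityToPoincare

/-- **Planted terminal Poincaré inequality** (stub S3 of line planted-link-pinning, UNCONDITIONAL; `μW`-binder form):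
for every compact `G`, lattice representation `r`, real `β` there is `ε₀ ∈ (0,1)` such that for every free density
`0 < ε ≤ ε₀` some `C ≥ 0` bounds the planted conditional variance `PCV_ε(F)` by `C` times the single-link heat-bath
Dirichlet form of `F`, for all volumes and all bounded measurable `F`.  Composition of the landed stubs S3c, S3d, S3e
through S3f. [folklore] -/
theorem plantedTerminal_holds :
    ∀ (G : Type) [Group G] [TopologicalSpace G] [IsTopologicalGroup G] [CompactSpace G]
      [MeasurableSpace G] [BorelSpace G] (r : LatticeRep G) (β : ℝ),
      ∃ ε₀ : ℝ, 0 < ε₀ ∧ ε₀ < 1 ∧ ∀ ε : ℝ, 0 < ε → ε ≤ ε₀ → ∃ C : ℝ, 0 ≤ C ∧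
      ∀ (S : ℕ) (μW : Measure (GaugeConfig 4 (2 * S + 1) G)),
      μW = (wilsonMeasure r.ρ β : Measure (GaugeConfig 4 (2 * S + 1) G)) →
      ∀ (F : GaugeConfig 4 (2 * S + 1) G → ℝ), Measurable F → (∃ M : ℝ, ∀ U, |F U| ≤ M) →
      (∑ Λ : Finset (Edge 4 (2 * S + 1)),
        ε ^ (Fintype.card (Edge 4 (2 * S + 1)) - Λ.card) * (1 - ε) ^ Λ.card *
          ∫ U, condVar (⨆ ℓ ∈ Λ, MeasurableSpace.comap (fun V : GaugeConfig 4 (2 * S + 1) G => V ℓ) inferInstance)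
            F μW U ∂μW) ≤
        C * ∑ ℓ : Edge 4 (2 * S + 1), ∫ U, ∫ g, (F U - F (Function.update U ℓ g)) ^ 2
          ∂((haarProbability G).tilted (fun g' => -β * wilsonAction r.ρ (Function.update U ℓ g'))) ∂μW :=
  fun G _ _ _ _ _ _ r β =>
    stub_plantedTerminal G r β (stub_linkSetPoincare G r β) (stub_pinnedClusterBound G r β) stub_freeClusterTail

/-- **Planted terminal Poincaré inequality**, direct form over `wilsonMeasure r.ρ β` (no measure binder). [folklore] -/
theorem plantedTerminal_wilsonMeasure (G : Type) [Group G] [TopologicalSpace G] [IsTopologicalGroup G]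
    [CompactSpace G] [MeasurableSpace G] [BorelSpace G] (r : LatticeRep G) (β : ℝ) :
    ∃ ε₀ : ℝ, 0 < ε₀ ∧ ε₀ < 1 ∧ ∀ ε : ℝ, 0 < ε → ε ≤ ε₀ → ∃ C : ℝ, 0 ≤ C ∧
      ∀ (S : ℕ) (F : GaugeConfig 4 (2 * S + 1) G → ℝ), Measurable F → (∃ M : ℝ, ∀ U, |F U| ≤ M) →
      (∑ Λ : Finset (Edge 4 (2 * S + 1)),
        ε ^ (Fintype.card (Edge 4 (2 * S + 1)) - Λ.card) * (1 - ε) ^ Λ.card *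
          ∫ U, condVar (⨆ ℓ ∈ Λ, MeasurableSpace.comap (fun V : GaugeConfig 4 (2 * S + 1) G => V ℓ) inferInstance)
            F (wilsonMeasure r.ρ β : Measure (GaugeConfig 4 (2 * S + 1) G)) U
            ∂(wilsonMeasure r.ρ β : Measure (GaugeConfig 4 (2 * S + 1) G))) ≤
        C * ∑ ℓ : Edge 4 (2 * S + 1), ∫ U, ∫ g, (F U - F (Function.update U ℓ g)) ^ 2
          ∂((haarProbability G).tilted (fun g' => -β * wilsonAction r.ρ (Function.update U ℓ g')))
          ∂(wilsonMeasure r.ρ β : Measure (GaugeConfig 4 (2 * S + 1) G)) := by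
  obtain ⟨ε₀, hε₀, hε₀1, h⟩ := plantedTerminal_holds G r β
  refine ⟨ε₀, hε₀, hε₀1, fun ε hε hεε₀ => ?_⟩
  obtain ⟨C, hC, hC'⟩ := h ε hε hεε₀
  exact ⟨C, hC, fun S F hF hM => hC' S _ rfl F hF hM⟩

end Summit.QuantumFields.YangMills.Theorems.SusceptibilityToPoincare

end
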